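import Summits.NavierStokesRegularity.NavierStokesRegularity.Theorems.TypeILiouvilleTypeIliouvilleLPersistentRegime
import Summits.NavierStokesRegularity.NavierStokesRegularity.Theorems.TypeILiouvilleTypeIliouvilleLMildGaugeEquivalence
import Summits.NavierStokesRegularity.NavierStokesRegularity.Theorems.SqueezeCycleExtremalElementExistsRegularity
import Literature.Analysis.FluidPDE.AncientL3BackwardLiouvilleHolds
import Literature.Analysis.FluidPDE.TypeIAncientMild
import Literature.Analysis.FluidPDE.NSLerayBlowupRateLpProofs
import HarnessLib

/-!
# Crux `TypeIliouvilleL` (stmt-NavierStokesRegularity-10661): the persistent half in print's class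

Support file for the crux `TypeIliouvilleL` (= KNSS's Liouville conjecture (L) over the tree's
duality-form class), line `registered`, cycle 4. The line splits (L) into the Type-I regime
(L' = `stub_typeIAncientLiouville_knssGauge` = item `SymmetryModuliCount.TypeIAncientLiouville`,
stmt-4050) and the persistent regime. Cycles 1–3 carried the persistent half as S3
(`stub_persistent_backward_L3_decay`: far-past `L³` recurrence to constants for members of the
DUALITY-FORM class which are not in the Type-I regime). This file moves the persistent half to
PRINT's class of mild bounded ancient solutions (KNSS 2009 §1 p. 3, §4 (i): fields continuous and
uniformly bounded on `(−∞,0) × ℝ³`, weakly divergence free, solving the Oseen integral equation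
`v(t) = e^{(t−s)Δ}v(s) − B¹_s(v,v)(t)`), where no Galilean gauge and no parasitic drift occur:

* **S3ᵐ** (`PersistentMildL3Recurrence`, written out in every signature below; no definition is
  introduced): every such `v` whose sup norm is NOT `O((−t)^{-1/2})` is `L³`-close (`≤ M`) to
  constants `b_k` along some `τ_k → −∞`.

Kernel-checked here:

* `oseenMild_const_of_backward_L3_modConst` — far-past `L³` recurrence to constants forces a mild
  bounded ancient `v` to be constant (Albritton–Barker 2019 Thm 1.2
  `AlbrittonBarker2019_liouville_L3_backward_holds` after the landed `L³`-propagation modulo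
  constants `stub_oseen_L3_modConst_propagation` and constant boost `stub_oseen_const_boost`);
* `oseenMild_liouville_of_knssGauge_of_persistentMild` — L' and S3ᵐ give (L) for print's class
  (Type-I branch: `isTypeIAncientMild_of_continuous_oseenMild`, KNSS Prop. 4.1 regularity);
* `TypeIliouvilleL_of_knssGauge_of_persistentMild` — hence the crux (Oseen gauge theorem,
  `TypeIliouvilleL_of_oseenMild_const`);
* `persistentMild_of_persistentL3` — S3 ⟹ S3ᵐ (the new stub is weaker than or equal to the old);
* `persistentMild_of_TypeIliouvilleL`, `TypeIliouvilleL_iff_knssGauge_and_persistentMild` — the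
  crux is EQUIVALENT to L' ∧ S3ᵐ (the reshaped skeleton stays lossless);
* `persistentMild_iff_oseenMild_liouville_persistent` — S3ᵐ is exactly print's (L) restricted to
  the persistent (non-Type-I) mild bounded ancient solutions.

## References

* G. Koch, N. Nadirashvili, G. Seregin, V. Šverák, Acta Math. 203 (2009) = arXiv:0709.3599, §1
  p. 3 (conjecture (L)), §4 (i), Prop. 4.1. [KochNadirashviliSereginSverak2009]
* D. Albritton, T. Barker, J. Math. Fluid Mech. 21 (2019) = arXiv:1811.00502, Thm 1.2.
  [AlbrittonBarker2019]
-/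

-- the summit and its single problem share the name (D-0017 nested layout)
set_option linter.dupNamespace false

noncomputable section

open MeasureTheory Filter Set Function Metric
open scoped Topology ENNReal NNReal

namespace Summit.NavierStokesRegularity.NavierStokesRegularity.Theorems

open Literature.Analysis Literature.Analysis.FluidPDE
open TypeIliouvilleL.BackwardL3 TypeIliouvilleL.MildGauge TypeIliouvilleL.PersistentRegime




/-- **Far-past `L³` recurrence to constants forces a mild bounded ancient solution to be constant**
(print's class). If `v` is continuous and uniformly bounded on `(−∞,0) × ℝ³`, weakly divergence free,
Oseen-mild for all `s < t < 0`, and `‖v(τ_k) − b_k‖_{L³} ≤ M` along times `τ_k < 0`, `τ_k → −∞`,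
then `v` is constant in space and time. Proof: the constants `b_k` coincide (`L³` modulo a constant
propagates forward along `v`, `stub_oseen_L3_modConst_propagation`, and a nonzero constant is not in
`L³(ℝ³)`); the constant Galilean boost `w(t,y) = v(t, y + t b) − b` (`stub_oseen_const_boost`) is a
mild bounded ancient field bounded in `L³` along `τ_k`, so Albritton–Barker 2019 Thm 1.2
(`AlbrittonBarker2019_liouville_L3_backward_holds`) gives `w ≡ 0`, i.e. `v ≡ b`.
[cite: AlbrittonBarker2019, Thm 1.2 (arXiv:1811.00502)] -/
theorem oseenMild_const_of_backward_L3_modConst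
    (v : ℝ → EuclideanSpace ℝ (Fin 3) → EuclideanSpace ℝ (Fin 3))
    (hvc : ContinuousOn (uncurry v) (Iio 0 ×ˢ univ))
    (hvK : ∃ K : ℝ, ∀ t < 0, ∀ x, ‖v t x‖ ≤ K)
    (hvd : ∀ t < 0, IsWeaklyDivFree (v t))
    (hvm : ∀ s t : ℝ, s < t → t < 0 → ∀ x,
      v t x = UnboundedOperators.heatExtension (v s) (t - s) x - oseenDuhamel 1 s v v t x)
    (hL3 : ∃ (b : ℕ → EuclideanSpace ℝ (Fin 3)) (τ : ℕ → ℝ) (M : NNReal),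
      (∀ k, τ k < 0) ∧ Tendsto τ atTop atBot ∧
      ∀ k, eLpNorm (fun x => v (τ k) x - b k) 3
        (volume : Measure (EuclideanSpace ℝ (Fin 3))) ≤ (M : ENNReal)) :
    ∃ e : EuclideanSpace ℝ (Fin 3), ∀ t < 0, ∀ x, v t x = e := by
  obtain ⟨d, τ, M, hτ0, hτlim, hL3⟩ := hL3
  have hvcont : ∀ k, Continuous (v (τ k)) := fun k =>
    hvc.comp_continuous (Continuous.prodMk_right (τ k)) fun x => mem_prod.2 ⟨hτ0 k, mem_univ x⟩
  have hmemv : ∀ k, MemLp (fun y => v (τ k) y - d k) 3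
      (volume : Measure (EuclideanSpace ℝ (Fin 3))) := fun k =>
    ⟨((hvcont k).sub continuous_const).aestronglyMeasurable, (hL3 k).trans_lt ENNReal.coe_lt_top⟩
  -- the constants agree
  have hdeq : ∀ k, d k = d 0 := by
    intro k
    rcases lt_trichotomy (τ k) (τ 0) with hlt | heq | hgt
    · have h1 : MemLp (fun y => v (τ 0) y - d k) 3 (volume : Measure (EuclideanSpace ℝ (Fin 3))) :=
        stub_oseen_L3_modConst_propagation v (d k) (τ k) (τ 0) hlt (hτ0 0) hvc hvK hvd hvm (hmemv k)
      exact const_eq_of_memLp_sub h1 (hmemv 0)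
    · have h1 : MemLp (fun y => v (τ 0) y - d k) 3 (volume : Measure (EuclideanSpace ℝ (Fin 3))) := by
        have := hmemv k
        rwa [heq] at this
      exact const_eq_of_memLp_sub h1 (hmemv 0)
    · have h1 : MemLp (fun y => v (τ k) y - d 0) 3 (volume : Measure (EuclideanSpace ℝ (Fin 3))) :=
        stub_oseen_L3_modConst_propagation v (d 0) (τ 0) (τ k) hgt (hτ0 k) hvc hvK hvd hvm (hmemv 0)
      exact (const_eq_of_memLp_sub h1 (hmemv k)).symm
  -- the boosted field
  set e : EuclideanSpace ℝ (Fin 3) := d 0 with he_def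
  set w : ℝ → EuclideanSpace ℝ (Fin 3) → EuclideanSpace ℝ (Fin 3) := fun t y => v t (y + t • e) - e
    with hw_def
  obtain ⟨hwc, hwK, hwd, hwm⟩ := stub_oseen_const_boost v e hvc hvK hvd hvm
  -- its `L³` norms along `τ k`
  have hwL3 : ∀ k, eLpNorm (w (τ k)) 3 (volume : Measure (EuclideanSpace ℝ (Fin 3))) ≤ M := by
    intro k
    have h1 : eLpNorm (fun y => v (τ k) (y + τ k • e) - e) 3
          (volume : Measure (EuclideanSpace ℝ (Fin 3))) =
        eLpNorm (fun y => v (τ k) y - e) 3 (volume : Measure (EuclideanSpace ℝ (Fin 3))) :=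
      eLpNorm_comp_add_const (g := fun y => v (τ k) y - e) ((hvcont k).sub continuous_const) _
    show eLpNorm (fun y => v (τ k) (y + τ k • e) - e) 3
      (volume : Measure (EuclideanSpace ℝ (Fin 3))) ≤ M
    rw [h1]
    have h2 := hL3 k
    rwa [hdeq k] at h2
  -- Albritton–Barker: `w ≡ 0`
  have hw0 : ∀ t < 0, ∀ x, w t x = 0 :=
    AlbrittonBarker2019_liouville_L3_backward_holds hwc hwK hwd hwm
      ⟨τ, (M : ENNReal), ENNReal.coe_lt_top, hτlim, hτ0, hwL3⟩
  -- hence `v ≡ e` on the slab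
  refine ⟨e, fun t ht z => ?_⟩
  have h := hw0 t ht (z - t • e)
  simp only [hw_def, sub_add_cancel, sub_eq_zero] at h
  exact h

/-- **(L) for print's class from its two halves: L' in the KNSS gauge and S3ᵐ.** If every jointly
smooth Oseen-mild ancient field with the Type-I bound `‖u(t,x)‖ ≤ C/√(−t)` vanishes (L' = item
`SymmetryModuliCount.TypeIAncientLiouville`, stmt-4050) and every mild bounded ancient solution
which is NOT in the Type-I regime is `L³`-close to constants along a sequence of times `τ_k → −∞`
(S3ᵐ), then every mild bounded ancient solution (continuous, uniformly bounded, weakly divergence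
free, Oseen-mild on `(−∞,0) × ℝ³`) is constant in space and time. Type-I branch: KNSS Prop. 4.1
regularity puts `v` in L' 's class (`isTypeIAncientMild_of_continuous_oseenMild`,
`isTypeIAncientMild_iff`), so `v ≡ 0`; persistent branch: `oseenMild_const_of_backward_L3_modConst`.
[cite: KochNadirashviliSereginSverak2009, §1 p. 3 and Prop. 4.1 (arXiv:0709.3599)] -/
theorem oseenMild_liouville_of_knssGauge_of_persistentMild
    (hL' : ∀ (C : ℝ) (u : ℝ → EuclideanSpace ℝ (Fin 3) → EuclideanSpace ℝ (Fin 3)),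
      ContDiffOn ℝ (⊤ : ℕ∞) (Function.uncurry u) (Set.Iio 0 ×ˢ Set.univ) ∧
      (∀ t < 0, Literature.Analysis.FluidPDE.VectorCalculus.IsDivFree (u t)) ∧
      (∀ s t : ℝ, s < t → t < 0 → ∀ x,
        u t x = Literature.Analysis.FluidPDE.heatFlow (u s) (t - s) x -
          ∫ τ in Set.Ioo s t, ∫ y,
            Literature.Analysis.FluidPDE.oseenKernel (t - τ) (x - y) (u τ y) (u τ y)) ∧
      Literature.Analysis.FluidPDE.HasTypeITimeDecay C u →
      ∀ t < 0, ∀ x, u t x = 0)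
    (hS3 : ∀ v : ℝ → EuclideanSpace ℝ (Fin 3) → EuclideanSpace ℝ (Fin 3),
      ContinuousOn (uncurry v) (Iio 0 ×ˢ univ) →
      (∃ K : ℝ, ∀ t < 0, ∀ x, ‖v t x‖ ≤ K) →
      (∀ t < 0, Literature.Analysis.FluidPDE.IsWeaklyDivFree (v t)) →
      (∀ s t : ℝ, s < t → t < 0 → ∀ x,
        v t x = Literature.Analysis.UnboundedOperators.heatExtension (v s) (t - s) x -
          Literature.Analysis.FluidPDE.oseenDuhamel 1 s v v t x) →
      (¬ ∃ C : ℝ, ∀ t < 0, ∀ x, ‖v t x‖ ≤ C / Real.sqrt (-t)) →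
      ∃ (b : ℕ → EuclideanSpace ℝ (Fin 3)) (τ : ℕ → ℝ) (M : NNReal),
        (∀ k, τ k < 0) ∧ Tendsto τ atTop atBot ∧
        ∀ k, eLpNorm (fun x => v (τ k) x - b k) 3
          (volume : Measure (EuclideanSpace ℝ (Fin 3))) ≤ (M : ENNReal)) :
    ∀ v : ℝ → EuclideanSpace ℝ (Fin 3) → EuclideanSpace ℝ (Fin 3),
      ContinuousOn (uncurry v) (Iio 0 ×ˢ univ) →
      (∃ K : ℝ, ∀ t < 0, ∀ x, ‖v t x‖ ≤ K) →
      (∀ t < 0, Literature.Analysis.FluidPDE.IsWeaklyDivFree (v t)) →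
      (∀ s t : ℝ, s < t → t < 0 → ∀ x,
        v t x = Literature.Analysis.UnboundedOperators.heatExtension (v s) (t - s) x -
          Literature.Analysis.FluidPDE.oseenDuhamel 1 s v v t x) →
      ∃ b : EuclideanSpace ℝ (Fin 3), ∀ t < 0, ∀ x, v t x = b := by
  intro v hvc hvK hvd hvm
  by_cases hI : ∃ C : ℝ, ∀ t < 0, ∀ x, ‖v t x‖ ≤ C / Real.sqrt (-t)
  · obtain ⟨C, hC⟩ := hI
    have hT : IsTypeIAncientMild C v := isTypeIAncientMild_of_continuous_oseenMild hvc hvd hvm hC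
    exact ⟨0, hL' C v (isTypeIAncientMild_iff.1 hT)⟩
  · exact oseenMild_const_of_backward_L3_modConst v hvc hvK hvd hvm (hS3 v hvc hvK hvd hvm hI)

/-- **The crux from L' and S3ᵐ** (the reshaped skeleton's composition, kernel-checked): (L) for
print's class (`oseenMild_liouville_of_knssGauge_of_persistentMild`) and the Oseen gauge theorem
(`TypeIliouvilleL_of_oseenMild_const`). [cite: KochNadirashviliSereginSverak2009, §1 p. 3, §4 (i)–(ii) (arXiv:0709.3599)] -/
theorem TypeIliouvilleL_of_knssGauge_of_persistentMild
    (hL' : ∀ (C : ℝ) (u : ℝ → EuclideanSpace ℝ (Fin 3) → EuclideanSpace ℝ (Fin 3)),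
      ContDiffOn ℝ (⊤ : ℕ∞) (Function.uncurry u) (Set.Iio 0 ×ˢ Set.univ) ∧
      (∀ t < 0, Literature.Analysis.FluidPDE.VectorCalculus.IsDivFree (u t)) ∧
      (∀ s t : ℝ, s < t → t < 0 → ∀ x,
        u t x = Literature.Analysis.FluidPDE.heatFlow (u s) (t - s) x -
          ∫ τ in Set.Ioo s t, ∫ y,
            Literature.Analysis.FluidPDE.oseenKernel (t - τ) (x - y) (u τ y) (u τ y)) ∧
      Literature.Analysis.FluidPDE.HasTypeITimeDecay C u →
      ∀ t < 0, ∀ x, u t x = 0)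
    (hS3 : ∀ v : ℝ → EuclideanSpace ℝ (Fin 3) → EuclideanSpace ℝ (Fin 3),
      ContinuousOn (uncurry v) (Iio 0 ×ˢ univ) →
      (∃ K : ℝ, ∀ t < 0, ∀ x, ‖v t x‖ ≤ K) →
      (∀ t < 0, Literature.Analysis.FluidPDE.IsWeaklyDivFree (v t)) →
      (∀ s t : ℝ, s < t → t < 0 → ∀ x,
        v t x = Literature.Analysis.UnboundedOperators.heatExtension (v s) (t - s) x -
          Literature.Analysis.FluidPDE.oseenDuhamel 1 s v v t x) →
      (¬ ∃ C : ℝ, ∀ t < 0, ∀ x, ‖v t x‖ ≤ C / Real.sqrt (-t)) →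
      ∃ (b : ℕ → EuclideanSpace ℝ (Fin 3)) (τ : ℕ → ℝ) (M : NNReal),
        (∀ k, τ k < 0) ∧ Tendsto τ atTop atBot ∧
        ∀ k, eLpNorm (fun x => v (τ k) x - b k) 3
          (volume : Measure (EuclideanSpace ℝ (Fin 3))) ≤ (M : ENNReal)) :
    Summit.NavierStokesRegularity.NavierStokesRegularity.Theses.TypeILiouville.TypeIliouvilleL :=
  TypeIliouvilleL_of_oseenMild_const (oseenMild_liouville_of_knssGauge_of_persistentMild hL' hS3)

/-- **S3 ⟹ S3ᵐ: the persistent stub in print's class is weaker than or equal to the duality-form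
stub.** A mild bounded ancient `v` is a member of the duality-form class
(`isBoundedAncientMildSolution_of_oseen`) with continuous slices; if it is not in the Type-I regime
pointwise it is not in the Type-I regime a.e. either (an a.e. bound on a continuous slice holds
everywhere), so S3 supplies the far-past `L³` recurrence. -/
theorem persistentMild_of_persistentL3 : (∀ u : ℝ → EuclideanSpace ℝ (Fin 3) → EuclideanSpace ℝ (Fin 3), Literature.Analysis.FluidPDE.IsBoundedAncientMildSolution 1 u → (∀ t < 0, AEStronglyMeasurable (u t) volume) → (¬ ∃ C : ℝ, ∀ t < 0, ∀ᵐ x ∂(volume : Measure (EuclideanSpace ℝ (Fin 3))), ‖u t x‖ ≤ C / Real.sqrt (-t)) → ∃ (b : ℝ → EuclideanSpace ℝ (Fin 3)) (τ : ℕ → ℝ) (M : NNReal), (∀ k, τ k < 0) ∧ Tendsto τ atTop atBot ∧ ∀ k, eLpNorm (fun x => u (τ k) x - b (τ k)) 3 (volume : Measure (EuclideanSpace ℝ (Fin 3))) ≤ (M : ENNReal)) → (∀ v : ℝ → EuclideanSpace ℝ (Fin 3) → EuclideanSpace ℝ (Fin 3), ContinuousOn (uncurry v) (Iio 0 ×ˢ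 univ) → (∃ K : ℝ, ∀ t < 0, ∀ x, ‖v t x‖ ≤ K) → (∀ t < 0, Literature.Analysis.FluidPDE.IsWeaklyDivFree (v t)) → (∀ s t : ℝ, s < t → t < 0 → ∀ x, v t x = Literature.Analysis.UnboundedOperators.heatExtension (v s) (t - s) x - Literature.Analysis.FluidPDE.oseenDuhamel 1 s v v t x) → (¬ ∃ C : ℝ, ∀ t < 0, ∀ x, ‖v t x‖ ≤ C / Real.sqrt (-t)) → ∃ (b : ℕ → EuclideanSpace ℝ (Fin 3)) (τ : ℕ → ℝ) (M : NNReal), (∀ k, τ k < 0) ∧ Tendsto τ atTop atBot ∧ ∀ k, eLpNorm (fun x => v (τ k) x - b k) 3 (volume : Measure (EuclideanSpace ℝ (Fin 3))) ≤ (M : ENNReal)) := by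
  intro hS3 v hvc hvK hvd hvm hper
  have hvm1 : ∀ s t : ℝ, s < t → t < 0 → ∀ x,
      v t x = UnboundedOperators.heatExtension (v s) (1 * (t - s)) x - oseenDuhamel 1 s v v t x := by
    intro s t hst ht x
    rw [one_mul]
    exact hvm s t hst ht x
  have hv : IsBoundedAncientMildSolution 1 v :=
    isBoundedAncientMildSolution_of_oseen one_pos hvc hvK hvd hvm1
  have hvsl : ∀ t < 0, Continuous (v t) := fun t ht =>
    hvc.comp_continuous (Continuous.prodMk_right t) fun x => mem_prod.2 ⟨ht, mem_univ x⟩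
  have hmeas : ∀ t < 0, AEStronglyMeasurable (v t) volume := fun t ht =>
    (hvsl t ht).aestronglyMeasurable
  have hper' : ¬ ∃ C : ℝ, ∀ t < 0, ∀ᵐ x ∂(volume : Measure (EuclideanSpace ℝ (Fin 3))),
      ‖v t x‖ ≤ C / Real.sqrt (-t) := by
    rintro ⟨C, hC⟩
    exact hper ⟨C, fun t ht x => forall_norm_le_of_ae_norm_le (hvsl t ht) (hC t ht) x⟩
  obtain ⟨b, τ, M, hτ0, hτlim, hL3⟩ := hS3 v hv hmeas hper'
  exact ⟨fun k => b (τ k), τ, M, hτ0, hτlim, hL3⟩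

/-- **The crux implies S3ᵐ** (with `M = 0`: under (L) a mild bounded ancient `v` is a constant `b`,
`oseenMild_const_of_TypeIliouvilleL`, and `‖v(τ_k) − b‖_{L³} = 0` along `τ_k = −(k+1)`). -/
theorem persistentMild_of_TypeIliouvilleL
    (hL : Summit.NavierStokesRegularity.NavierStokesRegularity.Theses.TypeILiouville.TypeIliouvilleL) :
    ∀ v : ℝ → EuclideanSpace ℝ (Fin 3) → EuclideanSpace ℝ (Fin 3),
      ContinuousOn (uncurry v) (Iio 0 ×ˢ univ) →
      (∃ K : ℝ, ∀ t < 0, ∀ x, ‖v t x‖ ≤ K) →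
      (∀ t < 0, Literature.Analysis.FluidPDE.IsWeaklyDivFree (v t)) →
      (∀ s t : ℝ, s < t → t < 0 → ∀ x,
        v t x = Literature.Analysis.UnboundedOperators.heatExtension (v s) (t - s) x -
          Literature.Analysis.FluidPDE.oseenDuhamel 1 s v v t x) →
      (¬ ∃ C : ℝ, ∀ t < 0, ∀ x, ‖v t x‖ ≤ C / Real.sqrt (-t)) →
      ∃ (b : ℕ → EuclideanSpace ℝ (Fin 3)) (τ : ℕ → ℝ) (M : NNReal),
        (∀ k, τ k < 0) ∧ Tendsto τ atTop atBot ∧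
        ∀ k, eLpNorm (fun x => v (τ k) x - b k) 3
          (volume : Measure (EuclideanSpace ℝ (Fin 3))) ≤ (M : ENNReal) := by
  intro v hvc hvK hvd hvm _
  obtain ⟨b, hb⟩ := oseenMild_const_of_TypeIliouvilleL hL v hvc hvK hvd hvm
  refine ⟨fun _ => b, fun k => -((k : ℝ) + 1), 0, fun k => ?_, tendsto_neg_natCast_add_one_atBot,
    fun k => ?_⟩
  · have : (0 : ℝ) ≤ k := Nat.cast_nonneg k
    linarith
  · have hk : -((k : ℝ) + 1) < 0 := by
      have : (0 : ℝ) ≤ k := Nat.cast_nonneg k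
      linarith
    have h0 : (fun x => v (-((k : ℝ) + 1)) x - b) = fun _ => (0 : EuclideanSpace ℝ (Fin 3)) := by
      funext x
      rw [hb _ hk x, sub_self]
    rw [h0]
    simp

/-- **The reshaped skeleton is lossless: the crux is EQUIVALENT to L' ∧ S3ᵐ.**
(→: `typeIAncientLiouville_knssGauge_of_TypeIliouvilleL` and `persistentMild_of_TypeIliouvilleL`;
←: `TypeIliouvilleL_of_knssGauge_of_persistentMild`.) [cite: KochNadirashviliSereginSverak2009, §1 p. 3 (arXiv:0709.3599)] -/
theorem TypeIliouvilleL_iff_knssGauge_and_persistentMild : Summit.NavierStokesRegularity.NavierStokesRegularity.Theses.TypeILiouville.TypeIliouvilleL ↔ ((∀ (C : ℝ) (u : ℝ → EuclideanSpace ℝ (Fin 3) → EuclideanSpace ℝ (Fin 3)), ContDiffOn ℝ (⊤ : ℕ∞) (Function.uncurry u) (Set.Iio 0 ×ˢ Set.univ) ∧ (∀ t < 0, Literature.Analysis.FluidPDE.VectorCalculus.IsDivFree (u t)) ∧ (∀ s t : ℝ, s < t → t < 0 → ∀ x, u t x = Literature.Analysis.FluidPDE.heatFlow (u s) (t - s)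 x - ∫ τ in Set.Ioo s t, ∫ y, Literature.Analysis.FluidPDE.oseenKernel (t - τ) (x - y) (u τ y) (u τ y)) ∧ Literature.Analysis.FluidPDE.HasTypeITimeDecay C u → ∀ t < 0, ∀ x, u t x = 0) ∧ (∀ v : ℝ → EuclideanSpace ℝ (Fin 3) → EuclideanSpace ℝ (Fin 3), ContinuousOn (uncurry v) (Iio 0 ×ˢ univ) → (∃ K : ℝ, ∀ t < 0, ∀ x, ‖v t x‖ ≤ K) → (∀ t < 0, Literature.Analysis.FluidPDE.IsWeaklyDivFree (v t)) → (∀ s t : ℝ, s < t → t < 0 → ∀ x, v t x = Literature.Analysis.UnboundedOperators.heatExtension (v s) (t - s) x - Literature.Analysis.FluidPDE.oseenDuhamel 1 s v v t x) → (¬ ∃ C : ℝ, ∀ t < 0, ∀ x, ‖v t x‖ ≤ C / Real.sqrt (-t)) → ∃ (b : ℕ → EuclideanSpace ℝ (Fin 3)) (τ : ℕ → ℝ) (M : NNReal), (∀ k, τ k < 0) ∧ Tendsto τ atTop atBot ∧ ∀ k, eLpNorm (fun x => v (τ k) x - b k) 3 (volume : Measure (EuclideanSpace ℝ (Fin 3)))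 ≤ (M : ENNReal))) :=
  ⟨fun hL => ⟨typeIAncientLiouville_knssGauge_of_TypeIliouvilleL hL, persistentMild_of_TypeIliouvilleL hL⟩,
    fun h => TypeIliouvilleL_of_knssGauge_of_persistentMild h.1 h.2⟩

/-- **S3ᵐ is exactly print's (L) restricted to the persistent (non-Type-I) mild bounded ancient
solutions**: far-past `L³` recurrence to constants for such `v` is equivalent to their constancy
(→: `oseenMild_const_of_backward_L3_modConst`; ←: recurrence with `M = 0`). This is the clean
printed form of the open persistent half of (L); it contains every bounded non-constant steady,
travelling or time-periodic mild solution as a potential counterexample (KNSS 2009 p. 3: (L) is open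
"even in the steady-state case"). [cite: KochNadirashviliSereginSverak2009, §1 p. 3 (arXiv:0709.3599)] -/
theorem persistentMild_iff_oseenMild_liouville_persistent : (∀ v : ℝ → EuclideanSpace ℝ (Fin 3) → EuclideanSpace ℝ (Fin 3), ContinuousOn (uncurry v) (Iio 0 ×ˢ univ) → (∃ K : ℝ, ∀ t < 0, ∀ x, ‖v t x‖ ≤ K) → (∀ t < 0, Literature.Analysis.FluidPDE.IsWeaklyDivFree (v t)) → (∀ s t : ℝ, s < t → t < 0 → ∀ x, v t x = Literature.Analysis.UnboundedOperators.heatExtension (v s) (t - s) x - Literature.Analysis.FluidPDE.oseenDuhamel 1 s v v t x) → (¬ ∃ C : ℝ, ∀ t < 0, ∀ x, ‖v t x‖ ≤ C / Real.sqrt (-t)) → ∃ (b : ℕ → EuclideanSpace ℝ (Fin 3)) (τ : ℕ → ℝ) (M : NNReal), (∀ k, τ k < 0) ∧ Tendsto τ atTop atBot ∧ ∀ k, eLpNorm (fun x => v (τ k) x - b k) 3 (volume : Measure (EuclideanSpace ℝ (Fin 3))) ≤ (M : ENNReal)) ↔ (∀ v : ℝ → EuclideanSpace ℝ (Fin 3)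 → EuclideanSpace ℝ (Fin 3), ContinuousOn (uncurry v) (Iio 0 ×ˢ univ) → (∃ K : ℝ, ∀ t < 0, ∀ x, ‖v t x‖ ≤ K) → (∀ t < 0, Literature.Analysis.FluidPDE.IsWeaklyDivFree (v t)) → (∀ s t : ℝ, s < t → t < 0 → ∀ x, v t x = Literature.Analysis.UnboundedOperators.heatExtension (v s) (t - s) x - Literature.Analysis.FluidPDE.oseenDuhamel 1 s v v t x) → (¬ ∃ C : ℝ, ∀ t < 0, ∀ x, ‖v t x‖ ≤ C / Real.sqrt (-t)) → ∃ b : EuclideanSpace ℝ (Fin 3), ∀ t < 0, ∀ x, v t x = b) := by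
  constructor
  · intro h v hvc hvK hvd hvm hper
    exact oseenMild_const_of_backward_L3_modConst v hvc hvK hvd hvm (h v hvc hvK hvd hvm hper)
  · intro h v hvc hvK hvd hvm hper
    obtain ⟨b, hb⟩ := h v hvc hvK hvd hvm hper
    refine ⟨fun _ => b, fun k => -((k : ℝ) + 1), 0, fun k => ?_, tendsto_neg_natCast_add_one_atBot,
      fun k => ?_⟩
    · have : (0 : ℝ) ≤ k := Nat.cast_nonneg k
      linarith
    · have hk : -((k : ℝ) + 1) < 0 := by
        have : (0 : ℝ) ≤ k := Nat.cast_nonneg k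
        linarith
      have h0 : (fun x => v (-((k : ℝ) + 1)) x - b) = fun _ => (0 : EuclideanSpace ℝ (Fin 3)) := by
        funext x
        rw [hb _ hk x, sub_self]
      rw [h0]
      simp

end Summit.NavierStokesRegularity.NavierStokesRegularity.Theorems

end
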